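import Summits.QuantumFields.YangMills.Theorems.CovariantDischargeSandwichFractionalOfCapped
import Summits.QuantumFields.YangMills.Theorems.CovariantDischargeSandwichSweepGapCapped
import HarnessLib

/-!
# Route `CovariantDischarge`, crux r2 `SandwichFractionalWindowTailL` (stmt-QuantumFields-24186) — CLOSED BY NAME:
# w5 g15's knit ✓`sandwichFractionalWindowTailL_of_capped` at px8 g8's ✓`stub_sandwichSweepGapCapped`

Cell `ym3-torus` (YM ladder rung R3 = continuum SU(2) Yang–Mills on the three-torus — a RUNG, NOT the Clay problem: not d = 4, not infinite volume,
not a mass gap); WIDTH seat `ym3-torus-px8` gen 8 on ★★OWNER WORD 28 (first refusal) and LEAD ★w1-19936 g10 WORD 1 2026-08-29T15:40:55Z («GO — px8 g8 files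
… `sandwichFractionalWindowTailL_proof` … `--workitem stmt-QuantumFields-24186`»).  ONE theorem, default heartbeats, 0 `def`.
HONEST SCOPE: this inhabits the route decl `Theses.CovariantDischarge.SandwichFractionalWindowTailL` (the ladder-uniform sandwich window tail with the
coupled range); the route's residual `SandwichDeepWindowTailL` (stmt-QuantumFields-24187), the shared crux `UnitScaleTilt.HistoryTailL`
(stmt-QuantumFields-19936) and every summit statement remain OPEN; YM₃ on T³ is rung R3, not Clay.
[cite: Balaban1985UV3, (1)-(3) p.256, (7) p.257, (71) p.273; Balaban1985Averaging, (10)-(12) p.19]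
-/

noncomputable section

namespace Summit.QuantumFields.YangMills.Theorems.CovariantDischargeSandwichFractionalWindowTailL

/-- ★★★ **THE CRUX r2 OF ROUTE `CovariantDischarge`**: the ladder-uniform sandwich fractional-window tail `SandwichFractionalWindowTailL` holds —
✓`CovariantDischargeSandwichFractionalOfCapped.sandwichFractionalWindowTailL_of_capped` (bounded depth ✓p706476, large ✓p708497, large-base ✓p710808,
the three-regime merge) applied to the capped sweep-gap stub ✓`CovariantDischargeSandwichSweepGapCapped.stub_sandwichSweepGapCapped` (the B6 door).
[cite: Balaban1985UV3, (7) p.257 and (71) p.273] -/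
theorem sandwichFractionalWindowTailL_proof : Summit.QuantumFields.YangMills.Theses.CovariantDischarge.SandwichFractionalWindowTailL :=
  CovariantDischargeSandwichFractionalOfCapped.sandwichFractionalWindowTailL_of_capped
    CovariantDischargeSandwichSweepGapCapped.stub_sandwichSweepGapCapped

end Summit.QuantumFields.YangMills.Theorems.CovariantDischargeSandwichFractionalWindowTailL

end
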